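import Summits.AtomisticToContinuum.HydrodynamicLimit.Theorems.ImplosionDichotomyHsEosLowDensity
import HarnessLib

/-!
# Cell → torus reduction, piece (B3, first half): the hard-sphere free volume, UNIFORMLY in the density
# (crux `CellForecastPressureDecay`, stmt-AtomisticToContinuum-13915; line `entropy-ball-invariant-states`,
# stub `stub_torusReduction`, step (i) of its proof plan: the partition-function ratio)

The cell → torus reduction compares the free volumes `hsFreeVolume η n` of the SAME `n ≤ 2L³` spheres at the two
nearby reduced densities `η = nσ³/L³` and `η' = nσ³/(L+σ)³`, uniformly in `n`. The PROVED equation of state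
`ImplosionDichotomy.HsEosLowDensity` (`Theorems.hsEosLowDensity_proof`) gives `-n⁻¹ log hsFreeVolume η n → F(η)`
for each fixed `η ∈ [0, η₀)`, `F` analytic; uniformity in `η` follows from MONOTONICITY in `η` (the free volume
decreases with the diameter) and continuity of `F` — Pólya's lemma (`tendstoUniformlyOn_of_monotoneOn`, proved
here in `ε`–`N` form). Results:

* `hsFreeVolume_antitone`, `hsFreeVolume_nonneg`, `hsFreeVolume_pos` (`0 ≤ η ≤ 1/8`, all `n`, by the grid
  configuration of `volume_setOf_lt_euclidDist_pos`);
* `eos_uniform`: `∃ η₁ ∈ (0, 1/8]`, `F` continuous on `[0, η₁]` with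
  `sup_{η ∈ [0,η₁]} |-n⁻¹ log hsFreeVolume η n - F η| → 0`;
* `hsFreeVolume_ratio_le_exp`: for every `α > 0` there are `β > 0`, `N₀` with
  `hsFreeVolume η n ≤ e^{α n} hsFreeVolume η' n` whenever `N₀ ≤ n`, `0 ≤ η ≤ η' ≤ η₁`, `η' - η ≤ β`;
* `exists_half_le_volume_posDomain`: for fixed `n`, `vol (posDomain ε n) ≥ 1/2` for all small `ε > 0`
  (continuity from below; the small-`n` regime of the reduction).

All declarations live in the sub-namespace `…Theorems.EntropyBall.TorusReduction`.
-/

noncomputable section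

open MeasureTheory Set Filter Topology
open scoped ENNReal

namespace Summit.AtomisticToContinuum.HydrodynamicLimit.Theorems.EntropyBall

namespace TorusReduction

open Literature.MathematicalPhysics.KineticTheory (T3 V3 hsFreeVolume hsDiameter posDomain
  volume_setOf_lt_euclidDist_pos hsFreeVolume_le_one)
open Summit.AtomisticToContinuum.HydrodynamicLimit.Theorems.EosCesaro (hsFreeVolume_eq_toReal
  volume_setOf_forall_lt_euclidDist_eq)

/-! ## Pólya's lemma: monotone functions converging pointwise to a continuous limit converge uniformly -/

/-- **Pólya's lemma** on a compact interval, `ε`–`N` form: if every `g n` is monotone on `[a, b]`, `G` is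
continuous on `[a, b]` and `g n x → G x` for every `x ∈ [a, b]`, then `g n → G` uniformly on `[a, b]`. -/
theorem tendstoUniformlyOn_of_monotoneOn {g : ℕ → ℝ → ℝ} {G : ℝ → ℝ} {a b : ℝ} (hab : a ≤ b)
    (hg : ∀ n, MonotoneOn (g n) (Icc a b)) (hGc : ContinuousOn G (Icc a b))
    (hlim : ∀ x ∈ Icc a b, Tendsto (fun n => g n x) atTop (𝓝 (G x))) :
    ∀ ε : ℝ, 0 < ε → ∀ᶠ n in atTop, ∀ x ∈ Icc a b, |g n x - G x| ≤ ε := by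
  intro ε hε
  have hε2 : 0 < ε / 2 := by positivity
  -- uniform continuity of the limit
  obtain ⟨δ, hδ, hUC⟩ := Metric.uniformContinuousOn_iff.1
    (isCompact_Icc.uniformContinuousOn_of_continuous hGc) (ε / 2) hε2
  -- the grid
  set m : ℕ := ⌈(b - a) / δ⌉₊ + 1 with hm_def
  have hm0 : (0 : ℝ) < m := by rw [hm_def]; positivity
  set h : ℝ := (b - a) / m with hh_def
  have hh0 : 0 ≤ h := div_nonneg (sub_nonneg.2 hab) hm0.le
  have hhδ : h < δ := by
    rw [hh_def, div_lt_iff₀ hm0]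
    have h1 : (b - a) / δ < m := by
      rw [hm_def]; push_cast
      exact (Nat.le_ceil _).trans_lt (lt_add_one _)
    rw [div_lt_iff₀ hδ] at h1
    linarith
  set t : ℕ → ℝ := fun k => a + k * h with ht_def
  have ht_mem : ∀ k, k ≤ m → t k ∈ Icc a b := by
    intro k hk
    refine ⟨by simp only [ht_def]; nlinarith [(Nat.cast_nonneg k : (0 : ℝ) ≤ k)], ?_⟩
    have hk' : (k : ℝ) ≤ m := by exact_mod_cast hk
    calc a + k * h ≤ a + m * h := by nlinarith
      _ = b := by rw [hh_def]; field_simp; ring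
  have htm : t m = b := by simp only [ht_def]; rw [hh_def]; field_simp; ring
  -- convergence at the finitely many grid points
  have hgrid : ∀ᶠ n in atTop, ∀ k : Fin (m + 1), |g n (t k) - G (t k)| ≤ ε / 2 := by
    refine eventually_all.2 fun k => ?_
    have hk : (k : ℕ) ≤ m := Nat.lt_succ_iff.1 k.isLt
    have := (hlim (t k) (ht_mem k hk)).eventually (Metric.closedBall_mem_nhds (G (t k)) hε2)
    filter_upwards [this] with n hn
    have hn' : dist (g n (t k)) (G (t k)) ≤ ε / 2 := hn
    rwa [Real.dist_eq] at hn'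
  filter_upwards [hgrid] with n hn x hx
  -- locate `x` between two consecutive grid points `t k ≤ x ≤ t (k + 1)`, `k + 1 ≤ m`
  obtain ⟨k, hkm, hkx, hxk⟩ : ∃ k : ℕ, k + 1 ≤ m ∧ t k ≤ x ∧ x ≤ t (k + 1) := by
    by_cases hh : h = 0
    · refine ⟨0, by omega, ?_, ?_⟩
      · simp only [ht_def, Nat.cast_zero, zero_mul, add_zero]; exact hx.1
      · have : b = a := by
          have := htm; simp only [ht_def, hh, mul_zero, add_zero] at this; exact this.symm
        simp only [ht_def, hh, mul_zero, add_zero]; rw [← this]; exact hx.2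
    · have hh0' : 0 < h := lt_of_le_of_ne hh0 (Ne.symm hh)
      set k₀ : ℕ := ⌊(x - a) / h⌋₊ with hk₀
      have hxa : 0 ≤ (x - a) / h := div_nonneg (sub_nonneg.2 hx.1) hh0'.le
      have hk₀le : (k₀ : ℝ) ≤ (x - a) / h := Nat.floor_le hxa
      have hk₀lt : (x - a) / h < k₀ + 1 := Nat.lt_floor_add_one _
      have hk₀m : k₀ ≤ m := by
        have hmh : (m : ℝ) * h = b - a := by rw [hh_def]; field_simp
        have h1 : (x - a) / h ≤ m := by
          rw [div_le_iff₀ hh0']; linarith [hx.2]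
        exact_mod_cast hk₀le.trans h1
      by_cases hkm : k₀ + 1 ≤ m
      · refine ⟨k₀, hkm, ?_, ?_⟩
        · simp only [ht_def]
          rw [le_div_iff₀ hh0'] at hk₀le; linarith
        · simp only [ht_def]; push_cast
          rw [div_lt_iff₀ hh0'] at hk₀lt; linarith
      · have hk₀eq : k₀ = m := by omega
        refine ⟨m - 1, by omega, ?_, ?_⟩
        · simp only [ht_def]
          have h1 : ((m - 1 : ℕ) : ℝ) ≤ k₀ := by exact_mod_cast (by omega : m - 1 ≤ k₀)
          rw [le_div_iff₀ hh0'] at hk₀le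
          nlinarith
        · have : m - 1 + 1 = m := by omega
          rw [this, htm]; exact hx.2
  have hk1 : |g n (t (k + 1)) - G (t (k + 1))| ≤ ε / 2 := hn ⟨k + 1, Nat.lt_succ_of_le hkm⟩
  have hk0 : |g n (t k) - G (t k)| ≤ ε / 2 := hn ⟨k, by omega⟩
  have htk : t k ∈ Icc a b := ht_mem k (by omega)
  have htk1 : t (k + 1) ∈ Icc a b := ht_mem (k + 1) hkm
  -- the limit varies by less than `ε/2` over a grid cell
  have hdist1 : dist (t (k + 1)) x < δ := by
    rw [Real.dist_eq, abs_of_nonneg (by linarith)]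
    have : t (k + 1) - t k = h := by simp only [ht_def]; push_cast; ring
    linarith
  have hdist0 : dist (t k) x < δ := by
    rw [Real.dist_eq, abs_of_nonpos (by linarith)]
    have : t (k + 1) - t k = h := by simp only [ht_def]; push_cast; ring
    linarith
  have hG1 := hUC _ htk1 _ hx hdist1
  have hG0 := hUC _ htk _ hx hdist0
  rw [Real.dist_eq] at hG1 hG0
  -- monotonicity of `g n`
  have hmono1 : g n x ≤ g n (t (k + 1)) := hg n hx htk1 hxk
  have hmono0 : g n (t k) ≤ g n x := hg n htk hx hkx
  rw [abs_lt] at hG1 hG0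
  rw [abs_le] at hk1 hk0 ⊢
  constructor <;> linarith [hk1.1, hk1.2, hk0.1, hk0.2, hG1.1, hG1.2, hG0.1, hG0.2]

/-! ## The free volume: monotonicity, bounds, positivity -/

/-- The free volume is nonnegative. -/
theorem hsFreeVolume_nonneg (η : ℝ) (n : ℕ) : 0 ≤ hsFreeVolume η n := ENNReal.toReal_nonneg

/-- **The free volume decreases with the density**: `0 ≤ η ≤ η' → hsFreeVolume η' n ≤ hsFreeVolume η n`
(the diameter `(η/n)^{1/3}` increases, the non-overlap set shrinks). -/
theorem hsFreeVolume_antitone {η η' : ℝ} (h0 : 0 ≤ η) (h : η ≤ η') (n : ℕ) :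
    hsFreeVolume η' n ≤ hsFreeVolume η n := by
  unfold hsFreeVolume
  refine ENNReal.toReal_mono (measure_ne_top _ _) (measure_mono fun q hq i j hij => ?_)
  refine lt_of_le_of_lt (Real.rpow_le_rpow (div_nonneg h0 (Nat.cast_nonneg n)) ?_ (by norm_num)) (hq i j hij)
  exact div_le_div_of_nonneg_right h (Nat.cast_nonneg n)

/-- The diameter at reduced density `η` for `N + 1` spheres is `hsDiameter (η^{1/3}) N`. -/
theorem rpow_div_succ_eq_hsDiameter {η : ℝ} (hη : 0 ≤ η) (N : ℕ) :
    (η / ((N + 1 : ℕ) : ℝ)) ^ (1 / 3 : ℝ) = hsDiameter (η ^ (1 / 3 : ℝ)) N := by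
  have hN : (0 : ℝ) ≤ ((N + 1 : ℕ) : ℝ) := by positivity
  rw [hsDiameter, Real.div_rpow hη hN, Real.rpow_neg hN, div_eq_mul_inv]

/-- **Positivity of the free volume** for `0 ≤ η ≤ 1/8` and every `n` (grid configuration at reduced
diameter `η^{1/3} ≤ 1/2`). -/
theorem hsFreeVolume_pos {η : ℝ} (h0 : 0 ≤ η) (h8 : η ≤ 1 / 8) (n : ℕ) : 0 < hsFreeVolume η n := by
  unfold hsFreeVolume
  refine ENNReal.toReal_pos (ne_of_gt ?_) (measure_ne_top _ _)
  cases n with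
  | zero =>
    have : {q : Fin 0 → T3 | ∀ i j, i ≠ j → (η / ((0 : ℕ) : ℝ)) ^ (1 / 3 : ℝ) <
        Literature.Analysis.FluidPDE.Torus.euclidDist (q i) (q j)} = univ :=
      eq_univ_of_forall fun q i => i.elim0
    rw [this, measure_univ]; exact one_pos
  | succ N =>
    have hσ : η ^ (1 / 3 : ℝ) ≤ 1 / 2 := by
      have h12 : ((1 / 2 : ℝ) ^ 3) ^ ((1 : ℝ) / 3) = 1 / 2 := by
        rw [show ((1 : ℝ) / 3) = ((3 : ℕ) : ℝ)⁻¹ by norm_num]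
        exact Real.pow_rpow_inv_natCast (by norm_num) (by norm_num)
      rw [← h12]
      exact Real.rpow_le_rpow h0 (by norm_num; exact h8) (by norm_num)
    have h := volume_setOf_lt_euclidDist_pos hσ N
    rwa [← rpow_div_succ_eq_hsDiameter h0 N] at h

/-- `-n⁻¹ log hsFreeVolume` is monotone in `η ∈ [0, 1/8]`. -/
theorem monotoneOn_neg_log_hsFreeVolume (n : ℕ) :
    MonotoneOn (fun η => -(n : ℝ)⁻¹ * Real.log (hsFreeVolume η n)) (Icc 0 (1 / 8)) := by
  intro η hη η' hη' h
  dsimp only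
  have hpos' : 0 < hsFreeVolume η' n := hsFreeVolume_pos hη'.1 hη'.2 n
  have hle : Real.log (hsFreeVolume η' n) ≤ Real.log (hsFreeVolume η n) :=
    Real.log_le_log hpos' (hsFreeVolume_antitone hη.1 h n)
  have hn : 0 ≤ (n : ℝ)⁻¹ := inv_nonneg.2 (Nat.cast_nonneg n)
  nlinarith

/-! ## The equation of state, uniformly in the density -/

/-- **Uniform equation of state at low density**: there are `η₁ ∈ (0, 1/8]` and `F` continuous on `[0, η₁]`
such that `-n⁻¹ log hsFreeVolume η n → F η` UNIFORMLY in `η ∈ [0, η₁]` (Pólya's lemma on the PROVED pointwise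
limit `ImplosionDichotomy.HsEosLowDensity`, the functions being monotone in `η`). -/
theorem eos_uniform : ∃ η₁ : ℝ, 0 < η₁ ∧ η₁ ≤ 1 / 8 ∧ ∃ F : ℝ → ℝ, ContinuousOn F (Icc 0 η₁) ∧
    ∀ α : ℝ, 0 < α → ∀ᶠ n : ℕ in atTop, ∀ η ∈ Icc 0 η₁,
      |-(n : ℝ)⁻¹ * Real.log (hsFreeVolume η n) - F η| ≤ α := by
  obtain ⟨η₀, hη₀, F, hFa, -, -, -, hlim⟩ := hsEosLowDensity_proof
  refine ⟨min (η₀ / 2) (1 / 8), by positivity, min_le_right _ _, F, ?_, ?_⟩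
  · refine (hFa.continuousOn).mono fun η hη => ?_
    exact ⟨by linarith [hη.1], lt_of_le_of_lt hη.2 ((min_le_left _ _).trans_lt (by linarith))⟩
  · intro α hα
    refine tendstoUniformlyOn_of_monotoneOn (g := fun n η => -(n : ℝ)⁻¹ * Real.log (hsFreeVolume η n))
      (by positivity) (fun n => (monotoneOn_neg_log_hsFreeVolume n).mono
        (Icc_subset_Icc le_rfl (min_le_right _ _))) ?_ ?_ α hα
    · refine (hFa.continuousOn).mono fun η hη => ?_
      exact ⟨by linarith [hη.1], lt_of_le_of_lt hη.2 ((min_le_left _ _).trans_lt (by linarith))⟩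
    · intro η hη
      exact hlim η ⟨hη.1, lt_of_le_of_lt hη.2 ((min_le_left _ _).trans_lt (by linarith))⟩

/-- **The free-volume ratio at two nearby densities, uniformly in `n`**: with `η₁` as in `eos_uniform`, for
every `α > 0` there are `β > 0` and `N₀` such that `hsFreeVolume η n ≤ e^{α n} · hsFreeVolume η' n` whenever
`N₀ ≤ n`, `0 ≤ η ≤ η' ≤ η₁` and `η' - η ≤ β`. (The trivial direction `hsFreeVolume η' n ≤ hsFreeVolume η n` is
`hsFreeVolume_antitone`.) -/
theorem hsFreeVolume_ratio_le_exp : ∃ η₁ : ℝ, 0 < η₁ ∧ η₁ ≤ 1 / 8 ∧ ∀ α : ℝ, 0 < α →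
    ∃ β : ℝ, 0 < β ∧ ∃ N₀ : ℕ, ∀ n : ℕ, N₀ ≤ n → ∀ η η' : ℝ, 0 ≤ η → η ≤ η' → η' ≤ η₁ → η' - η ≤ β →
      hsFreeVolume η n ≤ Real.exp (α * n) * hsFreeVolume η' n := by
  obtain ⟨η₁, hη₁, hη₁8, F, hFc, hU⟩ := eos_uniform
  refine ⟨η₁, hη₁, hη₁8, fun α hα => ?_⟩
  have hα3 : 0 < α / 3 := by positivity
  obtain ⟨δ, hδ, hUC⟩ := Metric.uniformContinuousOn_iff.1
    (isCompact_Icc.uniformContinuousOn_of_continuous hFc) (α / 3) hα3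
  obtain ⟨N₀, hN₀⟩ := eventually_atTop.1 (hU (α / 3) hα3)
  refine ⟨δ / 2, by positivity, max N₀ 1, fun n hn η η' h0 hle h1 hβ => ?_⟩
  have hnN : N₀ ≤ n := le_of_max_le_left hn
  have hn1 : 1 ≤ n := le_of_max_le_right hn
  have hn0 : (0 : ℝ) < n := by exact_mod_cast hn1
  have hηm : η ∈ Icc 0 η₁ := ⟨h0, hle.trans h1⟩
  have hη'm : η' ∈ Icc 0 η₁ := ⟨h0.trans hle, h1⟩
  have hA := hN₀ n hnN η hηm
  have hB := hN₀ n hnN η' hη'm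
  have hC := hUC η hηm η' hη'm (by rw [Real.dist_eq, abs_of_nonpos (by linarith)]; linarith)
  rw [Real.dist_eq] at hC
  have hpos : 0 < hsFreeVolume η n := hsFreeVolume_pos h0 ((hle.trans h1).trans hη₁8) n
  have hpos' : 0 < hsFreeVolume η' n := hsFreeVolume_pos (h0.trans hle) (h1.trans hη₁8) n
  -- `n⁻¹ (log FV η - log FV η') ≤ α`
  have key : (n : ℝ)⁻¹ * (Real.log (hsFreeVolume η n) - Real.log (hsFreeVolume η' n)) ≤ α := by
    rw [abs_le] at hA hB
    rw [abs_lt] at hC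
    nlinarith [hA.1, hA.2, hB.1, hB.2, hC.1, hC.2]
  rw [inv_mul_le_iff₀ hn0] at key
  calc hsFreeVolume η n = Real.exp (Real.log (hsFreeVolume η n)) := (Real.exp_log hpos).symm
    _ ≤ Real.exp (α * n + Real.log (hsFreeVolume η' n)) := Real.exp_le_exp.2 (by linarith)
    _ = Real.exp (α * n) * hsFreeVolume η' n := by rw [Real.exp_add, Real.exp_log hpos']

/-! ## Small particle numbers: the free volume tends to one with the diameter -/

/-- **For fixed `n` the non-overlap set fills the torus as the diameter tends to `0`**: there is `ε₀ > 0` with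
`vol (posDomain ε n) ≥ 1/2` for all `0 < ε ≤ ε₀` (continuity from below of Haar measure along
`posDomain (1/(k+1)) n ↑ {all pairwise distances > 0}`, a conull set). -/
theorem exists_half_le_volume_posDomain (n : ℕ) :
    ∃ ε₀ : ℝ, 0 < ε₀ ∧ ∀ ε : ℝ, 0 < ε → ε ≤ ε₀ → (1 / 2 : ℝ≥0∞) ≤ volume (posDomain ε n) := by
  set A : ℕ → Set (Fin n → T3) := fun k => posDomain (1 / ((k : ℝ) + 1)) n with hA
  have hmono : Monotone A := by
    intro k l hkl q hq i j hij
    refine le_trans ?_ (hq i j hij)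
    exact one_div_le_one_div_of_le (by positivity) (by exact_mod_cast Nat.succ_le_succ hkl)
  have hconull : volume (⋃ k, A k) = 1 := by
    refine le_antisymm prob_le_one ?_
    have hsub : {q : Fin n → T3 | ∀ i j, i ≠ j → (0 : ℝ) <
        Literature.Analysis.FluidPDE.Torus.euclidDist (q i) (q j)} ⊆ ⋃ k, A k := by
      intro q hq
      -- a positive lower bound on the finitely many pairwise distances
      obtain ⟨d, hd, hdq⟩ : ∃ d : ℝ, 0 < d ∧ ∀ i j, i ≠ j →
          d ≤ Literature.Analysis.FluidPDE.Torus.euclidDist (q i) (q j) := by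
        classical
        by_cases hne : (Finset.univ.filter fun p : Fin n × Fin n => p.1 ≠ p.2).Nonempty
        · let D : Fin n × Fin n → ℝ := fun p => Literature.Analysis.FluidPDE.Torus.euclidDist (q p.1) (q p.2)
          obtain ⟨p₀, hp₀, hmin⟩ := (Finset.univ.filter fun p : Fin n × Fin n => p.1 ≠ p.2).exists_min_image D hne
          refine ⟨D p₀, hq p₀.1 p₀.2 (Finset.mem_filter.1 hp₀).2, fun i j hij => ?_⟩
          exact hmin (i, j) (Finset.mem_filter.2 ⟨Finset.mem_univ _, hij⟩)
        · refine ⟨1, one_pos, fun i j hij => ?_⟩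
          exact absurd ⟨(i, j), Finset.mem_filter.2 ⟨Finset.mem_univ _, hij⟩⟩ hne
      obtain ⟨k, hk⟩ := exists_nat_one_div_lt hd
      exact mem_iUnion.2 ⟨k, fun i j hij => (hk.le).trans (hdq i j hij)⟩
    calc (1 : ℝ≥0∞) = volume (univ : Set (Fin n → T3)) := measure_univ.symm
      _ = volume {q : Fin n → T3 | ∀ i j, i ≠ j → (0 : ℝ) ≤
            Literature.Analysis.FluidPDE.Torus.euclidDist (q i) (q j)} := by
          congr 1; exact (eq_univ_of_forall fun q i j _ => norm_nonneg _).symm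
      _ = volume {q : Fin n → T3 | ∀ i j, i ≠ j → (0 : ℝ) <
            Literature.Analysis.FluidPDE.Torus.euclidDist (q i) (q j)} :=
          (volume_setOf_forall_lt_euclidDist_eq 0 n).symm
      _ ≤ volume (⋃ k, A k) := measure_mono hsub
  have ht := tendsto_measure_iUnion_atTop (μ := (volume : Measure (Fin n → T3))) hmono
  rw [hconull] at ht
  obtain ⟨k₀, hk₀⟩ := eventually_atTop.1 ((tendsto_order.1 ht).1 (1 / 2) (by norm_num))
  refine ⟨1 / ((k₀ : ℝ) + 1), by positivity, fun ε hε hεle => ?_⟩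
  refine (hk₀ k₀ le_rfl).le.trans (measure_mono fun q hq i j hij => hεle.trans (hq i j hij))

end TorusReduction

/-- **Registered helper stub `stub_trFreeVolume`** (piece (B3, free volume) of `stub_torusReduction`: Pólya's lemma, the free-volume ratio at two nearby densities uniformly in `n` (uniform EOS), and the small-`n` threshold): the conjunction of this file's main results, closed. -/
theorem stub_trFreeVolume : (∀ (g : ℕ → ℝ → ℝ) (G : ℝ → ℝ) (a b : ℝ), a ≤ b → (∀ n, MonotoneOn (g n) (Set.Icc a b)) → ContinuousOn G (Set.Icc a b) → (∀ x ∈ Set.Icc a b, Filter.Tendsto (fun n => g n x) Filter.atTop (nhds (G x))) → ∀ ε : ℝ, 0 < ε → ∀ᶠ n in Filter.atTop, ∀ x ∈ Set.Icc a b, |g n x - G x| ≤ ε) ∧ (∃ η₁ : ℝ, 0 < η₁ ∧ η₁ ≤ 1 / 8 ∧ ∀ α : ℝ, 0 < α → ∃ β : ℝ, 0 < β ∧ ∃ N₀ : ℕ, ∀ n : ℕ, N₀ ≤ n → ∀ η η' : ℝ, 0 ≤ η → η ≤ η' → η' ≤ η₁ → η' - η ≤ β → Literature.MathematicalPhysics.KineticTheory.hsFreeVolume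 η n ≤ Real.exp (α * n) * Literature.MathematicalPhysics.KineticTheory.hsFreeVolume η' n) ∧ (∀ n : ℕ, ∃ ε₀ : ℝ, 0 < ε₀ ∧ ∀ ε : ℝ, 0 < ε → ε ≤ ε₀ → (1 / 2 : ENNReal) ≤ MeasureTheory.volume (Literature.MathematicalPhysics.KineticTheory.posDomain ε n)) :=
  ⟨fun _ _ _ _ hab hg hGc hlim => TorusReduction.tendstoUniformlyOn_of_monotoneOn hab hg hGc hlim,
    TorusReduction.hsFreeVolume_ratio_le_exp, TorusReduction.exists_half_le_volume_posDomain⟩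


end Summit.AtomisticToContinuum.HydrodynamicLimit.Theorems.EntropyBall

end
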